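import Summits.QuantumFields.YangMills.Theorems.LuscherReductionTwistedTraceScalingBOStiffSlowAssembly
import HarnessLib

/-!
# (B-ST) step (B)/(S8.5), ALMOST-ORTHOGONALITY of the core piece, abstract: `(∫ 𝟙_S g·Θ·w̄)² ≤ 2(η²·Z + ν-tail)·‖g‖²_w` when `∫ gΘw = 0`
# (lane A of S-BASE, crux `TwistedTraceScaling` stmt-QuantumFields-20203, C4-CORE, the (B-ST) pen; design card `pub/ym-fleet/ym-luscher-20007-p1/Lines-BST-poincare.md` (B); HANDOFF-g21 (S8) step 5)

The stiff assembly `…BOStiffSlowAssembly.form_le_of_product_near` carries the fibrewise ground coefficients `C = ∫_u (∫_x v(u,x)Θ(x)w̄(x))²/Z du` of the CORE piece `v_in = 𝟙_S·v`;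
the hypothesis of `hST` is exact orthogonality of the FULL `v` in the TRUE (u-dependent) weight, `∫_x v(u,x)Θ(x)w_u(x) = 0` for every `u` (`fibreInner … = 0`).  The gap between the
two is a ν-tail (the profile mass off the core) and a weight comparison (`|w̄ − w_u| ≤ η·w_u` on the core, (P)):
★★ `sq_integral_core_profile_le` (one fibre `(X, μ)`, finite measure): if `∫ gΘw = 0`, `w ≥ 0`, and `|w̄ − w| ≤ η·w` on `S`, then
`(∫ 𝟙_S g·Θ·w̄)² ≤ 2·(η²·∫Θ²w + ∫(𝟙_{Sᶜ}Θ)²w)·∫ g²w` (Cauchy–Schwarz twice, `…BOStiffSlowAssembly.sq_integral_mul_weight_le`); ★★ `sq_integral_core_profile_le'` — the same with the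
weight comparison asked only on `S ∩ {g ≠ 0}`.  The record instance of the ν-tail
(`∫(𝟙_{Sᶜ}Θ)²w_u ≤ a·γ`, any `a > 0`, `S` = inner fibre ball ∩ gauge-near) is `…BOStiffFibreTail`; integrating over `u` gives the `C ≤ o(1)·N` input of the assembly.
HONEST FRAMING: bookkeeping for a stub of a child of the CONDITIONAL route R2b1; (B-ST) OPEN; C4-CORE OPEN; not infinite volume, not a gap, not Clay.
-/

set_option autoImplicit false

noncomputable section

open MeasureTheory


namespace Summit.QuantumFields.YangMills.Theorems.FemtoTransferGap.StiffDoor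

variable {X : Type*} [MeasurableSpace X] {μ : Measure X} [IsFiniteMeasure μ]

/-- ★★ **ALMOST-ORTHOGONALITY OF THE CORE PIECE.**  On a finite measure space let `g, Θ, w, w̄` be bounded measurable with `w ≥ 0`, `S` measurable, `|w̄ − w| ≤ η·w` on `S`,
and `∫ g·Θ·w = 0`.  Then `(∫ 𝟙_S g·Θ·w̄)² ≤ 2·(η²·∫ Θ²w + ∫ (𝟙_{Sᶜ}Θ)²w)·∫ g²w` (any real `η`). [folklore] -/
theorem sq_integral_core_profile_le {g Θ w wb : X → ℝ} {Cg CΘ Cw Cwb : ℝ} (hg : Measurable g) (hgb : ∀ x, |g x| ≤ Cg) (hΘ : Measurable Θ) (hΘb : ∀ x, |Θ x| ≤ CΘ)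
    (hw : Measurable w) (hwb : ∀ x, |w x| ≤ Cw) (hw0 : ∀ x, 0 ≤ w x) (hwb' : Measurable wb) (hwbb : ∀ x, |wb x| ≤ Cwb)
    {S : Set X} (hS : MeasurableSet S) {η : ℝ} (hcmp : ∀ x ∈ S, |wb x - w x| ≤ η * w x)
    (horth : ∫ x, g x * Θ x * w x ∂μ = 0) :
    (∫ x, S.indicator g x * Θ x * wb x ∂μ) ^ 2 ≤
      2 * (η ^ 2 * (∫ x, Θ x ^ 2 * w x ∂μ) + ∫ x, Sᶜ.indicator Θ x ^ 2 * w x ∂μ) * ∫ x, g x ^ 2 * w x ∂μ := by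
  -- the two pieces of the test function and of the profile
  set gS : X → ℝ := S.indicator g with hgSdef
  set ΘT : X → ℝ := Sᶜ.indicator Θ with hΘTdef
  have hgSm : Measurable gS := hg.indicator hS
  have hΘTm : Measurable ΘT := hΘ.indicator hS.compl
  have hgSb : ∀ x, |gS x| ≤ Cg := fun x => by
    by_cases hx : x ∈ S
    · simp only [hgSdef, Set.indicator_of_mem hx]; exact hgb x
    · simp only [hgSdef, Set.indicator_of_notMem hx, abs_zero]; exact (abs_nonneg _).trans (hgb x)
  have hΘTb : ∀ x, |ΘT x| ≤ CΘ := fun x => by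
    by_cases hx : x ∈ Sᶜ
    · simp only [hΘTdef, Set.indicator_of_mem hx]; exact hΘb x
    · simp only [hΘTdef, Set.indicator_of_notMem hx, abs_zero]; exact (abs_nonneg _).trans (hΘb x)
  have hCg0 : ∀ x : X, 0 ≤ Cg := fun x => (abs_nonneg _).trans (hgb x)
  have hCΘ0 : ∀ x : X, 0 ≤ CΘ := fun x => (abs_nonneg _).trans (hΘb x)
  -- integrability of the products
  have i3 : ∀ {a b c : X → ℝ} {Ca Cb Cc : ℝ}, Measurable a → (∀ x, |a x| ≤ Ca) → Measurable b → (∀ x, |b x| ≤ Cb) → Measurable c → (∀ x, |c x| ≤ Cc) →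
      Integrable (fun x => a x * b x * c x) μ := by
    intro a b c Ca Cb Cc ha hab hb hbb hc hcb
    refine integrable_of_measurable_abs_le μ ((ha.mul hb).mul hc) (C := Ca * Cb * Cc) fun x => ?_
    have hCa : 0 ≤ Ca := (abs_nonneg _).trans (hab x)
    rw [abs_mul, abs_mul]
    exact mul_le_mul (mul_le_mul (hab x) (hbb x) (abs_nonneg _) hCa) (hcb x) (abs_nonneg _) (mul_nonneg hCa ((abs_nonneg _).trans (hbb x)))
  have hwdm : Measurable fun x => wb x - w x := hwb'.sub hw
  have hwdb : ∀ x, |wb x - w x| ≤ Cwb + Cw := fun x => (abs_sub _ _).trans (add_le_add (hwbb x) (hwb x))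
  have iI₁ : Integrable (fun x => gS x * Θ x * (wb x - w x)) μ := i3 hgSm hgSb hΘ hΘb hwdm hwdb
  have iI₂ : Integrable (fun x => gS x * Θ x * w x) μ := i3 hgSm hgSb hΘ hΘb hw hwb
  have iI₃ : Integrable (fun x => g x * ΘT x * w x) μ := i3 hg hgb hΘTm hΘTb hw hwb
  -- `∫ 𝟙_S gΘw̄ = I₁ + I₂`, `I₂ = −∫ g(𝟙_{Sᶜ}Θ)w`
  have hsplit : ∫ x, gS x * Θ x * wb x ∂μ = (∫ x, gS x * Θ x * (wb x - w x) ∂μ) + ∫ x, gS x * Θ x * w x ∂μ := by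
    rw [← integral_add iI₁ iI₂]; exact integral_congr_ae (ae_of_all _ fun x => by ring)
  have hI₂ : ∫ x, gS x * Θ x * w x ∂μ = -∫ x, g x * ΘT x * w x ∂μ := by
    have e : ∀ x, g x * Θ x * w x = gS x * Θ x * w x + g x * ΘT x * w x := fun x => by
      by_cases hx : x ∈ S
      · simp only [hgSdef, hΘTdef, Set.indicator_of_mem hx, Set.indicator_of_notMem (Set.notMem_compl_iff.mpr hx)]; ring
      · simp only [hgSdef, hΘTdef, Set.indicator_of_notMem hx, Set.indicator_of_mem (Set.mem_compl hx)]; ring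
    have h := horth
    simp_rw [e] at h
    rw [integral_add iI₂ iI₃] at h
    linarith
  -- Cauchy–Schwarz for `I₁`: `|I₁| ≤ η ∫ |gS||Θ|w`, `(∫ |gS||Θ|w)² ≤ (∫ gS²w)(∫ Θ²w)`
  have hI₁ : |∫ x, gS x * Θ x * (wb x - w x) ∂μ| ≤ η * ∫ x, |gS x| * |Θ x| * w x ∂μ := by
    rw [← integral_const_mul]
    refine (abs_integral_le_integral_abs).trans (integral_mono_of_nonneg (ae_of_all _ fun x => abs_nonneg _) ?_ (ae_of_all _ fun x => ?_))
    · exact (i3 hgSm.abs (fun x => by rw [abs_abs]; exact hgSb x) hΘ.abs (fun x => by rw [abs_abs]; exact hΘb x) hw hwb).const_mul η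
    · show |gS x * Θ x * (wb x - w x)| ≤ η * (|gS x| * |Θ x| * w x)
      rw [abs_mul, abs_mul]
      by_cases hx : x ∈ S
      · calc |gS x| * |Θ x| * |wb x - w x| ≤ |gS x| * |Θ x| * (η * w x) := mul_le_mul_of_nonneg_left (hcmp x hx) (by positivity)
          _ = η * (|gS x| * |Θ x| * w x) := by ring
      · simp only [hgSdef, Set.indicator_of_notMem hx, abs_zero, zero_mul, mul_zero]; exact le_rfl
  have hCS₁ := sq_integral_mul_weight_le (μ := μ) hgSm.abs (fun x => by rw [abs_abs]; exact hgSb x) hΘ.abs (fun x => by rw [abs_abs]; exact hΘb x) hw hwb hw0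
  simp only [sq_abs] at hCS₁
  -- Cauchy–Schwarz for `I₂`
  have hCS₂ := sq_integral_mul_weight_le (μ := μ) hg hgb hΘTm hΘTb hw hwb hw0
  -- `∫ gS² w ≤ ∫ g² w`
  have hgS2 : ∫ x, gS x ^ 2 * w x ∂μ ≤ ∫ x, g x ^ 2 * w x ∂μ := by
    refine integral_mono_of_nonneg (ae_of_all _ fun x => mul_nonneg (sq_nonneg _) (hw0 x)) ?_ (ae_of_all _ fun x => ?_)
    · exact integrable_of_measurable_abs_le μ ((hg.pow_const 2).mul hw) (C := Cg ^ 2 * Cw) fun x => by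
        rw [abs_mul, abs_pow]; exact mul_le_mul (pow_le_pow_left₀ (abs_nonneg _) (hgb x) 2) (hwb x) (abs_nonneg _) (sq_nonneg _)
    · show gS x ^ 2 * w x ≤ g x ^ 2 * w x
      by_cases hx : x ∈ S
      · simp only [hgSdef, Set.indicator_of_mem hx]; exact le_rfl
      · simp only [hgSdef, Set.indicator_of_notMem hx]; nlinarith [hw0 x, sq_nonneg (g x)]
  -- assemble: `(I₁ + I₂)² ≤ 2I₁² + 2I₂²`
  set I₁ := ∫ x, gS x * Θ x * (wb x - w x) ∂μ
  set J := ∫ x, |gS x| * |Θ x| * w x ∂μ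
  set I₃ := ∫ x, g x * ΘT x * w x ∂μ
  set N := ∫ x, g x ^ 2 * w x ∂μ
  set NS := ∫ x, gS x ^ 2 * w x ∂μ
  set Z := ∫ x, Θ x ^ 2 * w x ∂μ
  set T := ∫ x, ΘT x ^ 2 * w x ∂μ
  have hN0 : 0 ≤ N := integral_nonneg fun x => mul_nonneg (sq_nonneg _) (hw0 x)
  have hZ0 : 0 ≤ Z := integral_nonneg fun x => mul_nonneg (sq_nonneg _) (hw0 x)
  have hNS0 : 0 ≤ NS := integral_nonneg fun x => mul_nonneg (sq_nonneg _) (hw0 x)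
  have hJ0 : 0 ≤ J := integral_nonneg fun x => mul_nonneg (mul_nonneg (abs_nonneg _) (abs_nonneg _)) (hw0 x)
  have h1 : I₁ ^ 2 ≤ η ^ 2 * (Z * N) := by
    have ha : |I₁| ≤ η * J := hI₁
    have hb : J ^ 2 ≤ NS * Z := hCS₁
    have hc : I₁ ^ 2 ≤ (η * J) ^ 2 := by
      rw [← sq_abs I₁]; exact pow_le_pow_left₀ (abs_nonneg _) ha 2
    calc I₁ ^ 2 ≤ (η * J) ^ 2 := hc
      _ = η ^ 2 * J ^ 2 := by ring
      _ ≤ η ^ 2 * (NS * Z) := mul_le_mul_of_nonneg_left hb (sq_nonneg _)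
      _ ≤ η ^ 2 * (N * Z) := mul_le_mul_of_nonneg_left (mul_le_mul_of_nonneg_right hgS2 hZ0) (sq_nonneg _)
      _ = η ^ 2 * (Z * N) := by ring
  have h2 : I₃ ^ 2 ≤ N * T := hCS₂
  rw [hsplit, hI₂]
  nlinarith [h1, h2, sq_nonneg (I₁ + I₃)]

/-- ★★ **ALMOST-ORTHOGONALITY OF THE CORE PIECE, weight comparison only on the support of `g`**: as `sq_integral_core_profile_le`, but the comparison `|w̄ − w| ≤ η·w` is required
only at points of `S` where `g ≠ 0` (for the record: where the test function lives, i.e. inside the fat tube, where (P) prices both weights). [folklore] -/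
theorem sq_integral_core_profile_le' {g Θ w wb : X → ℝ} {Cg CΘ Cw Cwb : ℝ} (hg : Measurable g) (hgb : ∀ x, |g x| ≤ Cg) (hΘ : Measurable Θ) (hΘb : ∀ x, |Θ x| ≤ CΘ)
    (hw : Measurable w) (hwb : ∀ x, |w x| ≤ Cw) (hw0 : ∀ x, 0 ≤ w x) (hwb' : Measurable wb) (hwbb : ∀ x, |wb x| ≤ Cwb)
    {S : Set X} (hS : MeasurableSet S) {η : ℝ} (hcmp : ∀ x ∈ S, g x ≠ 0 → |wb x - w x| ≤ η * w x)
    (horth : ∫ x, g x * Θ x * w x ∂μ = 0) :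
    (∫ x, S.indicator g x * Θ x * wb x ∂μ) ^ 2 ≤
      2 * (η ^ 2 * (∫ x, Θ x ^ 2 * w x ∂μ) + ∫ x, Sᶜ.indicator Θ x ^ 2 * w x ∂μ) * ∫ x, g x ^ 2 * w x ∂μ := by
  -- the two pieces of the test function and of the profile
  set gS : X → ℝ := S.indicator g with hgSdef
  set ΘT : X → ℝ := Sᶜ.indicator Θ with hΘTdef
  have hgSm : Measurable gS := hg.indicator hS
  have hΘTm : Measurable ΘT := hΘ.indicator hS.compl
  have hgSb : ∀ x, |gS x| ≤ Cg := fun x => by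
    by_cases hx : x ∈ S
    · simp only [hgSdef, Set.indicator_of_mem hx]; exact hgb x
    · simp only [hgSdef, Set.indicator_of_notMem hx, abs_zero]; exact (abs_nonneg _).trans (hgb x)
  have hΘTb : ∀ x, |ΘT x| ≤ CΘ := fun x => by
    by_cases hx : x ∈ Sᶜ
    · simp only [hΘTdef, Set.indicator_of_mem hx]; exact hΘb x
    · simp only [hΘTdef, Set.indicator_of_notMem hx, abs_zero]; exact (abs_nonneg _).trans (hΘb x)
  have hCg0 : ∀ x : X, 0 ≤ Cg := fun x => (abs_nonneg _).trans (hgb x)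
  have hCΘ0 : ∀ x : X, 0 ≤ CΘ := fun x => (abs_nonneg _).trans (hΘb x)
  -- integrability of the products
  have i3 : ∀ {a b c : X → ℝ} {Ca Cb Cc : ℝ}, Measurable a → (∀ x, |a x| ≤ Ca) → Measurable b → (∀ x, |b x| ≤ Cb) → Measurable c → (∀ x, |c x| ≤ Cc) →
      Integrable (fun x => a x * b x * c x) μ := by
    intro a b c Ca Cb Cc ha hab hb hbb hc hcb
    refine integrable_of_measurable_abs_le μ ((ha.mul hb).mul hc) (C := Ca * Cb * Cc) fun x => ?_
    have hCa : 0 ≤ Ca := (abs_nonneg _).trans (hab x)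
    rw [abs_mul, abs_mul]
    exact mul_le_mul (mul_le_mul (hab x) (hbb x) (abs_nonneg _) hCa) (hcb x) (abs_nonneg _) (mul_nonneg hCa ((abs_nonneg _).trans (hbb x)))
  have hwdm : Measurable fun x => wb x - w x := hwb'.sub hw
  have hwdb : ∀ x, |wb x - w x| ≤ Cwb + Cw := fun x => (abs_sub _ _).trans (add_le_add (hwbb x) (hwb x))
  have iI₁ : Integrable (fun x => gS x * Θ x * (wb x - w x)) μ := i3 hgSm hgSb hΘ hΘb hwdm hwdb
  have iI₂ : Integrable (fun x => gS x * Θ x * w x) μ := i3 hgSm hgSb hΘ hΘb hw hwb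
  have iI₃ : Integrable (fun x => g x * ΘT x * w x) μ := i3 hg hgb hΘTm hΘTb hw hwb
  -- `∫ 𝟙_S gΘw̄ = I₁ + I₂`, `I₂ = −∫ g(𝟙_{Sᶜ}Θ)w`
  have hsplit : ∫ x, gS x * Θ x * wb x ∂μ = (∫ x, gS x * Θ x * (wb x - w x) ∂μ) + ∫ x, gS x * Θ x * w x ∂μ := by
    rw [← integral_add iI₁ iI₂]; exact integral_congr_ae (ae_of_all _ fun x => by ring)
  have hI₂ : ∫ x, gS x * Θ x * w x ∂μ = -∫ x, g x * ΘT x * w x ∂μ := by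
    have e : ∀ x, g x * Θ x * w x = gS x * Θ x * w x + g x * ΘT x * w x := fun x => by
      by_cases hx : x ∈ S
      · simp only [hgSdef, hΘTdef, Set.indicator_of_mem hx, Set.indicator_of_notMem (Set.notMem_compl_iff.mpr hx)]; ring
      · simp only [hgSdef, hΘTdef, Set.indicator_of_notMem hx, Set.indicator_of_mem (Set.mem_compl hx)]; ring
    have h := horth
    simp_rw [e] at h
    rw [integral_add iI₂ iI₃] at h
    linarith
  -- Cauchy–Schwarz for `I₁`: `|I₁| ≤ η ∫ |gS||Θ|w`, `(∫ |gS||Θ|w)² ≤ (∫ gS²w)(∫ Θ²w)`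
  have hI₁ : |∫ x, gS x * Θ x * (wb x - w x) ∂μ| ≤ η * ∫ x, |gS x| * |Θ x| * w x ∂μ := by
    rw [← integral_const_mul]
    refine (abs_integral_le_integral_abs).trans (integral_mono_of_nonneg (ae_of_all _ fun x => abs_nonneg _) ?_ (ae_of_all _ fun x => ?_))
    · exact (i3 hgSm.abs (fun x => by rw [abs_abs]; exact hgSb x) hΘ.abs (fun x => by rw [abs_abs]; exact hΘb x) hw hwb).const_mul η
    · show |gS x * Θ x * (wb x - w x)| ≤ η * (|gS x| * |Θ x| * w x)
      rw [abs_mul, abs_mul]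
      by_cases hx : x ∈ S
      · by_cases hgx : g x = 0
        · simp only [hgSdef, Set.indicator_of_mem hx, hgx, abs_zero, zero_mul, mul_zero]; exact le_rfl
        · calc |gS x| * |Θ x| * |wb x - w x| ≤ |gS x| * |Θ x| * (η * w x) := mul_le_mul_of_nonneg_left (hcmp x hx hgx) (by positivity)
            _ = η * (|gS x| * |Θ x| * w x) := by ring
      · simp only [hgSdef, Set.indicator_of_notMem hx, abs_zero, zero_mul, mul_zero]; exact le_rfl
  have hCS₁ := sq_integral_mul_weight_le (μ := μ) hgSm.abs (fun x => by rw [abs_abs]; exact hgSb x) hΘ.abs (fun x => by rw [abs_abs]; exact hΘb x) hw hwb hw0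
  simp only [sq_abs] at hCS₁
  -- Cauchy–Schwarz for `I₂`
  have hCS₂ := sq_integral_mul_weight_le (μ := μ) hg hgb hΘTm hΘTb hw hwb hw0
  -- `∫ gS² w ≤ ∫ g² w`
  have hgS2 : ∫ x, gS x ^ 2 * w x ∂μ ≤ ∫ x, g x ^ 2 * w x ∂μ := by
    refine integral_mono_of_nonneg (ae_of_all _ fun x => mul_nonneg (sq_nonneg _) (hw0 x)) ?_ (ae_of_all _ fun x => ?_)
    · exact integrable_of_measurable_abs_le μ ((hg.pow_const 2).mul hw) (C := Cg ^ 2 * Cw) fun x => by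
        rw [abs_mul, abs_pow]; exact mul_le_mul (pow_le_pow_left₀ (abs_nonneg _) (hgb x) 2) (hwb x) (abs_nonneg _) (sq_nonneg _)
    · show gS x ^ 2 * w x ≤ g x ^ 2 * w x
      by_cases hx : x ∈ S
      · simp only [hgSdef, Set.indicator_of_mem hx]; exact le_rfl
      · simp only [hgSdef, Set.indicator_of_notMem hx]; nlinarith [hw0 x, sq_nonneg (g x)]
  -- assemble: `(I₁ + I₂)² ≤ 2I₁² + 2I₂²`
  set I₁ := ∫ x, gS x * Θ x * (wb x - w x) ∂μ
  set J := ∫ x, |gS x| * |Θ x| * w x ∂μ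
  set I₃ := ∫ x, g x * ΘT x * w x ∂μ
  set N := ∫ x, g x ^ 2 * w x ∂μ
  set NS := ∫ x, gS x ^ 2 * w x ∂μ
  set Z := ∫ x, Θ x ^ 2 * w x ∂μ
  set T := ∫ x, ΘT x ^ 2 * w x ∂μ
  have hN0 : 0 ≤ N := integral_nonneg fun x => mul_nonneg (sq_nonneg _) (hw0 x)
  have hZ0 : 0 ≤ Z := integral_nonneg fun x => mul_nonneg (sq_nonneg _) (hw0 x)
  have hNS0 : 0 ≤ NS := integral_nonneg fun x => mul_nonneg (sq_nonneg _) (hw0 x)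
  have hJ0 : 0 ≤ J := integral_nonneg fun x => mul_nonneg (mul_nonneg (abs_nonneg _) (abs_nonneg _)) (hw0 x)
  have h1 : I₁ ^ 2 ≤ η ^ 2 * (Z * N) := by
    have ha : |I₁| ≤ η * J := hI₁
    have hb : J ^ 2 ≤ NS * Z := hCS₁
    have hc : I₁ ^ 2 ≤ (η * J) ^ 2 := by
      rw [← sq_abs I₁]; exact pow_le_pow_left₀ (abs_nonneg _) ha 2
    calc I₁ ^ 2 ≤ (η * J) ^ 2 := hc
      _ = η ^ 2 * J ^ 2 := by ring
      _ ≤ η ^ 2 * (NS * Z) := mul_le_mul_of_nonneg_left hb (sq_nonneg _)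
      _ ≤ η ^ 2 * (N * Z) := mul_le_mul_of_nonneg_left (mul_le_mul_of_nonneg_right hgS2 hZ0) (sq_nonneg _)
      _ = η ^ 2 * (Z * N) := by ring
  have h2 : I₃ ^ 2 ≤ N * T := hCS₂
  rw [hsplit, hI₂]
  nlinarith [h1, h2, sq_nonneg (I₁ + I₃)]


end Summit.QuantumFields.YangMills.Theorems.FemtoTransferGap.StiffDoor

end
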